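import Literature.Barriers.CriticalPhenomena.PlaquetteWalkHoleRootChirality
import HarnessLib

/-!
# Barrier catalogue (SAWScalingLimit): the principal level-`5` members on the root row are ROW-COHERENT — `n_{VL} = 2` for the
all-left (slot `S`) members, `n_{VL} = 0` for the all-right (slot `N`) ones («ROW CLASSES»)

`Z → ∞` limit model of the printed Yang–Baxter weights [GlazmanManolescu2019, §1, eq. (1)]; the «RECTANGLE COEFFICIENT» line. Input:
`PlaquetteWalkHoleRootChirality.chirality_of_cost_five` (a cost-`5` wound class-`B2a` walk from the hole root with straight prefix and no
doubly visited plaquette turns five times the same way: LEFT to the `S` side, RIGHT to the `N` side). Here the turn-class bookkeeping of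
`PlaquetteWalkAngleLimitPhase` (`q = n_{HL} + n_{VL} − n_{HR} − n_{VR}`, `n_{H→V} − n_{V→H} = [a vertical] − [z vertical]`) turns chirality
into the counts that the PHASE LAW reads:

* `YBWalk.hrCount_eq_zero_of_left` / `vrCount_eq_zero_of_left` (no right-turn arcs when every turning arc is a left quarter turn) and the
  mirror statements `hlCount_eq_zero_of_right` / `vlCount_eq_zero_of_right`;
* ★★ `ΩG.classes_of_cost_five`: `(z₂ = S ∧ n_{HL} = 3 ∧ n_{VL} = 2 ∧ n_{HR} = n_{VR} = 0) ∨ (z₂ = N ∧ n_{HR} = 3 ∧ n_{VR} = 2 ∧ n_{HL} = n_{VL} = 0)`,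
  with `n_{w₁} = n_{w₂} = 0` — the census classes (S,3,2,0,0,+5) / (N,2,3,0,0,−5) of kit j276221 ('as'/'ac' resp. 'as'/'ao');
* ★★★ `ΩG.rowCoherent_of_cost_five`: hence `phaseIndex = 6` (slot `S`) or `0` (slot `N`) — the walk is ROW-COHERENT
  (`PlaquetteWalkAngleLimitRowCoherence.RowCoherent`), the hypothesis of `vertexFunctional_printed_zero_set_finite_of_rowCoherent` for
  these members.

Use (venture lane «pcv-sawmu», b-engine-1 g25; DESIGN-next-g24 §2bis): the class computation of the root-row programme for the class-`B2a`
members, conditional on (R2) no doubly visited plaquette and on the straight prefix (R3). [GlazmanManolescu2019 §1 Fig. 1, eq. (1), Lemma 2.1;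
Glazman 2015 Lemma 3.1 (proof, pp. 6–7)]
-/

noncomputable section

namespace Literature.Probability.RandomPlanarGeometry.SAW.YangBaxter

open Real
open Literature.Barriers.CriticalPhenomena.PlaquetteWalk

/-! ## Chirality kills two of the four turn classes -/

/-- The class indicator of an arc determines its quarter turn: an `HR` or `VR` arc is a right quarter turn. [cite: GlazmanManolescu2019, §1, Fig. 1; §2.1] -/
theorem qTurnOf_eq_neg_one_of_isHR_or_isVR (p : MidEdge × MidEdge)
    (h : (arcSides p).elim false isHR = true ∨ (arcSides p).elim false isVR = true) : qTurnOf p = -1 := by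
  rcases arc_data p with ⟨hn, -, -⟩ | ⟨s, t, -, hs, -, hq⟩
  · rw [hn] at h; simp at h
  · rw [hs] at h; rw [hq]; exact (qTurn_eq_neg_one_iff s t).2 (by simpa using h)

/-- An `HL` or `VL` arc is a left quarter turn. [cite: GlazmanManolescu2019, §1, Fig. 1; §2.1] -/
theorem qTurnOf_eq_one_of_isHL_or_isVL (p : MidEdge × MidEdge)
    (h : (arcSides p).elim false isHL = true ∨ (arcSides p).elim false isVL = true) : qTurnOf p = 1 := by
  rcases arc_data p with ⟨hn, -, -⟩ | ⟨s, t, -, hs, -, hq⟩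
  · rw [hn] at h; simp at h
  · rw [hs] at h; rw [hq]; exact (qTurn_eq_one_iff s t).2 (by simpa using h)

/-- ★ **ALL TURNS LEFT ⇒ `n_{HR} = n_{VR} = 0`.** [cite: GlazmanManolescu2019, §1, Fig. 1; §2.1] -/
theorem hrCount_vrCount_eq_zero_of_left (l : List MidEdge) (h : ∀ p ∈ arcsOf l, qTurnOf p ≠ 0 → qTurnOf p = 1) :
    hrCount l = 0 ∧ vrCount l = 0 := by
  unfold hrCount vrCount classCount
  refine ⟨List.countP_eq_zero.2 fun p hp hc => ?_, List.countP_eq_zero.2 fun p hp hc => ?_⟩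
  · have e := qTurnOf_eq_neg_one_of_isHR_or_isVR p (Or.inl hc)
    have := h p hp (by rw [e]; norm_num); rw [e] at this; norm_num at this
  · have e := qTurnOf_eq_neg_one_of_isHR_or_isVR p (Or.inr hc)
    have := h p hp (by rw [e]; norm_num); rw [e] at this; norm_num at this

/-- ★ **ALL TURNS RIGHT ⇒ `n_{HL} = n_{VL} = 0`.** [cite: GlazmanManolescu2019, §1, Fig. 1; §2.1] -/
theorem hlCount_vlCount_eq_zero_of_right (l : List MidEdge) (h : ∀ p ∈ arcsOf l, qTurnOf p ≠ 0 → qTurnOf p = -1) :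
    hlCount l = 0 ∧ vlCount l = 0 := by
  unfold hlCount vlCount classCount
  refine ⟨List.countP_eq_zero.2 fun p hp hc => ?_, List.countP_eq_zero.2 fun p hp hc => ?_⟩
  · have e := qTurnOf_eq_one_of_isHL_or_isVL p (Or.inl hc)
    have := h p hp (by rw [e]; norm_num); rw [e] at this; norm_num at this
  · have e := qTurnOf_eq_one_of_isHL_or_isVL p (Or.inr hc)
    have := h p hp (by rw [e]; norm_num); rw [e] at this; norm_num at this

/-! ## The classes and the row coherence of the principal cost-`5` members -/

namespace ΩG

variable {D : Set Face} {w r : Face} {ω : ΩG D (w.side .W) r}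

/-- ★★ **THE CLASSES OF THE PRINCIPAL COST-`5` MEMBERS.** A wound class-`B2a` walk of limit cost `5` from the hole root with straight
prefix and injective plaquette map has `n_{w₁} = n_{w₂} = 0` and EITHER returns to the `S` side of `r` with
`(n_{HL}, n_{VL}, n_{HR}, n_{VR}) = (3, 2, 0, 0)`, OR returns to the `N` side with `(n_{HL}, n_{VL}, n_{HR}, n_{VR}) = (0, 0, 3, 2)` — the
exact-census classes (kit j276221). [cite: GlazmanManolescu2019, §1, Fig. 1 and eq. (1); §2.1; Lemma 2.1 (statement, «in the form given in [Gl]»)]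
[cite: Glazman2015WeightedSAW, Lemma 3.1 (proof, pp. 6–7)] -/
theorem classes_of_cost_five (hh : holeFaceW w ∉ D) (hr : RootedFace D (w.side .W) r) (h : ω.IsB2a)
    (hA : ω.AJ hr h (toC (midPt (w.side .W))) ≠ 0) (hc : cost (slotOfSide ω.1) ω.2.mids = 5)
    (hinj : ∀ i j, i < ω.2.arcs.length → j < ω.2.arcs.length → ω.2.fc i = ω.2.fc j → i = j)
    (hstr : ∀ i < ω.2.firstHitG, arcKind (ω.2.sIn i) (ω.2.sOut i) = .straight) :
    cfgCount ω.2.mids [.corner, .corner] = 0 ∧ cfgCount ω.2.mids [.coCorner, .coCorner] = 0 ∧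
      ((ω.1 = .S ∧ hlCount ω.2.mids = 3 ∧ vlCount ω.2.mids = 2 ∧ hrCount ω.2.mids = 0 ∧ vrCount ω.2.mids = 0) ∨
        (ω.1 = .N ∧ hlCount ω.2.mids = 0 ∧ vlCount ω.2.mids = 0 ∧ hrCount ω.2.mids = 3 ∧ vrCount ω.2.mids = 2)) := by
  obtain ⟨hp1, hp2⟩ := ω.2.pairs_eq_zero_of_injective hinj
  refine ⟨hp1, hp2, ?_⟩
  have hq := quarterTurnsL_eq_classes ω.2.mids
  have htel := hvCount_sub_vhCount_walk ω.2
  obtain ⟨hhv, hvh⟩ := hvCount_eq ω.2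
  rw [hhv, hvh, (vertB_side w).1] at htel
  have hchi := chirality_of_cost_five hh hr h hA hc hinj hstr
  have hqt := quarterTurns_of_cost_five hh hr h hA hc hinj hstr
  rcases hchi with ⟨hS, hall⟩ | ⟨hN, hall⟩
  · left
    obtain ⟨h1, h2⟩ := hrCount_vrCount_eq_zero_of_left ω.2.mids hall
    have hz : vertB (r.side ω.1) = false := by rw [hS]; exact (vertB_side r).2.2.1
    rw [hz] at htel
    rcases hqt with ⟨-, h5⟩ | ⟨hN, -⟩
    · rw [h1, h2] at hq htel
      refine ⟨hS, ?_, ?_, h1, h2⟩ <;> push_cast at hq htel <;> simp at htel <;> omega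
    · rw [hS] at hN; exact absurd hN (by decide)
  · right
    obtain ⟨h1, h2⟩ := hlCount_vlCount_eq_zero_of_right ω.2.mids hall
    have hz : vertB (r.side ω.1) = false := by rw [hN]; exact (vertB_side r).2.2.2
    rw [hz] at htel
    rcases hqt with ⟨hS, -⟩ | ⟨-, h5⟩
    · rw [hN] at hS; exact absurd hS (by decide)
    · rw [h1, h2] at hq htel
      refine ⟨hN, h1, h2, ?_, ?_⟩ <;> push_cast at hq htel <;> simp at htel <;> omega

/-- ★★★ **THE PRINCIPAL COST-`5` MEMBERS ARE ROW-COHERENT**: a wound class-`B2a` walk of limit cost `5` from the hole root `w.side W` with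
straight prefix and no doubly visited plaquette has phase index `6` on the slot `S` and `0` on the slot `N` — it satisfies
`RowCoherent (slotOfSide ω.1) ω.2.mids`, the per-member hypothesis of the ROW-COHERENCE CRITERION
`vertexFunctional_printed_zero_set_finite_of_rowCoherent`. [cite: GlazmanManolescu2019, §1, Fig. 1 and eq. (1); Lemma 2.1, eq. (CR)]
[cite: Glazman2015WeightedSAW, Lemma 3.1 (proof, pp. 6–7)] -/
theorem rowCoherent_of_cost_five (hh : holeFaceW w ∉ D) (hr : RootedFace D (w.side .W) r) (h : ω.IsB2a)
    (hA : ω.AJ hr h (toC (midPt (w.side .W))) ≠ 0) (hc : cost (slotOfSide ω.1) ω.2.mids = 5)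
    (hinj : ∀ i j, i < ω.2.arcs.length → j < ω.2.arcs.length → ω.2.fc i = ω.2.fc j → i = j)
    (hstr : ∀ i < ω.2.firstHitG, arcKind (ω.2.sIn i) (ω.2.sOut i) = .straight) :
    RowCoherent (slotOfSide ω.1) ω.2.mids ∧
      ((ω.1 = .S ∧ phaseIndex ω.2.mids = 6) ∨ (ω.1 = .N ∧ phaseIndex ω.2.mids = 0)) := by
  obtain ⟨hp1, hp2, hcls⟩ := classes_of_cost_five hh hr h hA hc hinj hstr
  have hX : phaseIndex ω.2.mids = (3 * vlCount ω.2.mids) % 8 := by unfold phaseIndex; rw [hp1, hp2]; omega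
  rcases hcls with ⟨hS, -, hvl, -, -⟩ | ⟨hN, -, hvl, -, -⟩
  · have hX6 : phaseIndex ω.2.mids = 6 := by rw [hX, hvl]
    have hs : slotOfSide ω.1 = 3 := by rw [hS]; rfl
    refine ⟨?_, Or.inl ⟨hS, hX6⟩⟩
    rw [hs]; unfold RowCoherent
    refine ⟨fun h => absurd h (by decide), fun _ => Or.inr hX6, fun h => absurd h (by decide)⟩
  · have hX0 : phaseIndex ω.2.mids = 0 := by rw [hX, hvl]
    have hs : slotOfSide ω.1 = 1 := by rw [hN]; rfl
    refine ⟨?_, Or.inr ⟨hN, hX0⟩⟩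
    rw [hs]; unfold RowCoherent
    refine ⟨fun _ => Or.inl hX0, fun h => absurd h (by decide), fun h => absurd h (by decide)⟩

end ΩG

end Literature.Probability.RandomPlanarGeometry.SAW.YangBaxter
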